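import Mathlib.Algebra.MvPolynomial.Equiv
import Mathlib.ModelTheory.Complexity
import Literature.ModelTheory.ExponentialFields.SignDiagramTransfer
import Literature.ModelTheory.ExponentialFields.OrderedFieldModels
import HarnessLib

/-!
# Quantifier elimination for the theory of real closed fields (Tarski)

Support file for the discharge of the named fact
`Literature.ModelTheory.ExponentialFields.tarski_hasQE` (`RealExpField.lean`; Tarski 1951,
Seidenberg 1954; Marker 2002, Thm. 3.3.15): the theory `Theory.RCF` of real closed ordered fields
in the language `(+, *, -, 0, 1, ≤)` admits quantifier elimination
(`Literature.ModelTheory.ExponentialFields.RCFQE.hasQE_RCF : Theory.RCF.HasQE`).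

## Proof architecture (Cohen–Hörmander elimination, uniformly in the model)

By `BoundedFormula.induction_on_exists_not` it suffices to eliminate one existential quantifier
in front of a quantifier-free formula `χ(x̄, y)` (`RCFQE.exists_isQF_iff_ex`), uniformly in all
models of `RCF`:

1. *Terms are integer polynomials* (`RCFQE.termPoly`, `RCFQE.realize_eq_aeval_termPoly`), and
   every integer polynomial is a term (`RCFQE.polyTerm`); a quantifier-free `χ` holds at a point
   iff a fixed Boolean condition `RCFQE.dec χ` holds of the vector of signs of a fixed finite
   family `RCFQE.polys χ` of integer polynomials at that point (`RCFQE.realize_iff_dec`), in every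
   ordered ring.
2. Single out the quantified variable: the family becomes a finite family `Q ⊆ A[X]`,
   `A = ℤ[x̄]` (`RCFQE.toAX`, `RCFQE.eval_map_toAX`); enlarge it to a finite *stable* family `P`
   (`SignDiagram.exists_isStable_supset`) and let `C ⊆ A` be the finite set of coefficients of
   members of `P`.
3. By the parametric sign-diagram theorem *between two real closed fields*
   (`SignDiagramRCF.Transfer.exists_forall_sign_eval_map_eq`, file `SignDiagramTransfer.lean`;
   Basu–Pollack–Roy 2006, Lemma 2.74 / Thm. 2.76), whether `∃ y χ(x̄, y)` holds at a point `x̄` of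
   a model `M ⊨ RCF` only depends on the signs of the members of `C` at `x̄` — uniformly in `M`.
   Hence `∃ y χ` is `RCF`-equivalent to the (finite) disjunction, over the "good" sign conditions
   `τ` on `C` (those realized together with `∃ y χ` in *some* model), of the quantifier-free
   formulas "the signs of the members of `C` are `τ`".
4. Models of `RCF` are arbitrary `Language.orderedRing`-structures satisfying the axioms; the
   real closed ordered field structure on their universe is `OrderedFieldModel.Dom`
   (`OrderedFieldModels.lean`), along which realization of formulas is transported
   (`RCFQE.realize_dom_iff`).

## References

* A. Tarski, *A decision method for elementary algebra and geometry*, 2nd ed., UC Press (1951).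
* A. Seidenberg, *A new decision method for elementary algebra*, Ann. of Math. 60 (1954).
* P. J. Cohen, Decision procedures for real and `p`-adic fields, Comm. Pure Appl. Math. 22
  (1969), 131–151.
* S. Basu, R. Pollack, M.-F. Roy, *Algorithms in Real Algebraic Geometry*, 2nd ed., Springer
  (2006), Thm. 2.77 (quantifier elimination over real closed fields).
* D. Marker, *Model Theory: An Introduction*, Springer GTM 217 (2002), Thm. 3.3.15.
-/

noncomputable section

open FirstOrder FirstOrder.Language MvPolynomial

universe w

namespace Literature.ModelTheory.ExponentialFields

namespace RCFQE

/-! ### Terms of the language of ordered rings are integer polynomials -/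

section Terms

variable {γ : Type*}

/-- The `Language.orderedRing`-structure on the ring of integer polynomials `ℤ[Xᵢ : i ∈ γ]` given
by its ring operations (the relation `≤` is interpreted trivially; only the function symbols are
used). [folklore] -/
@[reducible] def polyStructure (γ : Type*) : Language.orderedRing.Structure (MvPolynomial γ ℤ) where
  funMap
  | .add, v => v 0 + v 1
  | .mul, v => v 0 * v 1
  | .neg, v => -v 0
  | .zero, _ => 0
  | .one, _ => 1
  RelMap
  | .le, _ => True

/-- The integer polynomial of a term of the language of ordered rings: the realization of the term
in `ℤ[Xᵢ : i ∈ γ]` at the valuation `i ↦ Xᵢ`. [folklore] -/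
def termPoly (t : Language.orderedRing.Term γ) : MvPolynomial γ ℤ :=
  @Term.realize Language.orderedRing (MvPolynomial γ ℤ) (polyStructure γ) γ MvPolynomial.X t

/-- **Terms are polynomials.** In any commutative ring carrying the structure generated by its
operations (`Language.orderedRing.instStructure`), a term is realized by the evaluation of its
integer polynomial. [folklore] -/
theorem realize_eq_aeval_termPoly {R : Type*} [CommRing R] [LE R]
    (t : Language.orderedRing.Term γ) (w : γ → R) :
    t.realize w = MvPolynomial.aeval w (termPoly t) := by
  induction t with
  | var i =>
    show w i = MvPolynomial.aeval w (MvPolynomial.X i)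
    rw [MvPolynomial.aeval_X]
  | func f ts ih =>
    cases f with
    | add =>
      show (ts 0).realize w + (ts 1).realize w =
        MvPolynomial.aeval w (termPoly (ts 0) + termPoly (ts 1))
      rw [map_add, ih 0, ih 1]
    | mul =>
      show (ts 0).realize w * (ts 1).realize w =
        MvPolynomial.aeval w (termPoly (ts 0) * termPoly (ts 1))
      rw [map_mul, ih 0, ih 1]
    | neg =>
      show -(ts 0).realize w = MvPolynomial.aeval w (-termPoly (ts 0))
      rw [map_neg, ih 0]
    | zero =>
      show (0 : R) = MvPolynomial.aeval w (0 : MvPolynomial γ ℤ)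
      rw [map_zero]
    | one =>
      show (1 : R) = MvPolynomial.aeval w (1 : MvPolynomial γ ℤ)
      rw [map_one]

/-- Every integer polynomial is the polynomial of a term. [folklore] -/
theorem termPoly_surjective : Function.Surjective (termPoly (γ := γ)) := by
  intro p
  induction p using MvPolynomial.induction_on with
  | C a =>
    induction a using Int.induction_on with
    | zero => exact ⟨0, by rw [MvPolynomial.C_0]; rfl⟩
    | succ n ih =>
      obtain ⟨t, ht⟩ := ih
      exact ⟨t + 1, by rw [map_add, map_one, ← ht]; rfl⟩
    | pred n ih =>
      obtain ⟨t, ht⟩ := ih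
      exact ⟨t + -1, by rw [map_sub, map_one, ← ht, sub_eq_add_neg]; rfl⟩
  | add p q hp hq =>
    obtain ⟨t₁, rfl⟩ := hp
    obtain ⟨t₂, rfl⟩ := hq
    exact ⟨t₁ + t₂, rfl⟩
  | mul_X p i hp =>
    obtain ⟨t, rfl⟩ := hp
    exact ⟨t * Term.var i, rfl⟩

/-- A term whose polynomial is the given integer polynomial (a choice). [folklore] -/
def polyTerm (p : MvPolynomial γ ℤ) : Language.orderedRing.Term γ :=
  (termPoly_surjective p).choose

/-- `polyTerm` is a right inverse of `termPoly`. [folklore] -/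
theorem termPoly_polyTerm (p : MvPolynomial γ ℤ) : termPoly (polyTerm p) = p :=
  (termPoly_surjective p).choose_spec

/-- The term of a polynomial realizes to the evaluation of the polynomial. [folklore] -/
theorem realize_polyTerm {R : Type*} [CommRing R] [LE R] (p : MvPolynomial γ ℤ) (w : γ → R) :
    (polyTerm p).realize w = MvPolynomial.aeval w p := by
  rw [realize_eq_aeval_termPoly, termPoly_polyTerm]

end Terms

/-! ### Singling out the last bound variable -/

section Split

variable {α : Type*} {m : ℕ}

/-- The variable map sending the last bound variable to `none` and every other variable to
itself. [folklore] -/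
def split : α ⊕ Fin (m + 1) → Option (α ⊕ Fin m) :=
  Sum.elim (fun a => some (Sum.inl a)) (Fin.lastCases none fun j => some (Sum.inr j))

/-- `split` on a free variable. [folklore] -/
@[simp] theorem split_inl (a : α) : (split (Sum.inl a) : Option (α ⊕ Fin m)) = some (Sum.inl a) :=
  rfl

/-- `split` on the last bound variable. [folklore] -/
@[simp] theorem split_inr_last : (split (Sum.inr (Fin.last m)) : Option (α ⊕ Fin m)) = none := by
  simp [split]

/-- `split` on the other bound variables. [folklore] -/
@[simp] theorem split_inr_castSucc (j : Fin m) :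
    (split (Sum.inr j.castSucc) : Option (α ⊕ Fin m)) = some (Sum.inr j) := by
  simp [split]

/-- An integer polynomial in the free and bound variables, viewed as a univariate polynomial in
the last bound variable over the ring of integer polynomials in the other variables. [folklore] -/
def toAX (F : MvPolynomial (α ⊕ Fin (m + 1)) ℤ) : Polynomial (MvPolynomial (α ⊕ Fin m) ℤ) :=
  optionEquivLeft ℤ (α ⊕ Fin m) (rename split F)

/-- Extending a valuation of the other variables by a value for the last bound variable.
[folklore] -/
def extend {R : Type*} (x : α ⊕ Fin m → R) (y : R) : α ⊕ Fin (m + 1) → R :=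
  fun i => (split i).elim y x

/-- `extend` in terms of `Fin.snoc`. [folklore] -/
theorem extend_sumElim {R : Type*} (v : α → R) (xs : Fin m → R) (y : R) :
    extend (Sum.elim v xs) y = Sum.elim v (Fin.snoc xs y) := by
  funext i
  rcases i with a | i
  · simp [extend]
  · refine Fin.lastCases ?_ (fun j => ?_) i
    · simp [extend]
    · simp [extend]

/-- **Evaluation in two stages.** Specializing the coefficients of `toAX F` at `x` and then
evaluating at `y` is evaluating `F` at the extended point. [folklore] -/
theorem eval_map_toAX {R : Type*} [CommRing R] (F : MvPolynomial (α ⊕ Fin (m + 1)) ℤ)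
    (x : α ⊕ Fin m → R) (y : R) :
    ((toAX F).map (MvPolynomial.aeval x).toRingHom).eval y =
      MvPolynomial.aeval (extend x y) F := by
  induction F using MvPolynomial.induction_on with
  | C a => simp [toAX]
  | add p q hp hq =>
    simp only [toAX, map_add, Polynomial.map_add, Polynomial.eval_add] at hp hq ⊢
    rw [hp, hq]
  | mul_X p i hp =>
    simp only [toAX, map_mul, Polynomial.map_mul, Polynomial.eval_mul] at hp ⊢
    rw [hp, MvPolynomial.rename_X, MvPolynomial.aeval_X]
    congr 1
    rcases i with a | i
    · simp [extend]
    · refine Fin.lastCases ?_ (fun j => ?_) i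
      · simp [extend]
      · simp [extend]

end Split

/-! ### Quantifier-free formulas as sign conditions on integer polynomials -/

section SignConditions

variable {α : Type*} [DecidableEq α]

/-- The polynomial of an atomic order formula `t₀ ≤ t₁`: `t₁ - t₀`. [folklore] -/
def relPolys {n : ℕ} : ∀ {l : ℕ}, Language.orderedRing.Relations l →
    (Fin l → Language.orderedRing.Term (α ⊕ Fin n)) → Finset (MvPolynomial (α ⊕ Fin n) ℤ)
  | _, .le, ts => {termPoly (ts 1) - termPoly (ts 0)}

/-- The finite family of integer polynomials of a bounded formula: differences of the polynomials
of the terms compared in its atomic subformulas (quantified subformulas are ignored; the family is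
used for quantifier-free formulas). [folklore] -/
def polys : ∀ {n : ℕ}, Language.orderedRing.BoundedFormula α n →
    Finset (MvPolynomial (α ⊕ Fin n) ℤ)
  | _, .falsum => ∅
  | _, .equal t₁ t₂ => {termPoly t₁ - termPoly t₂}
  | _, .rel R ts => relPolys R ts
  | _, .imp f₁ f₂ => polys f₁ ∪ polys f₂
  | _, .all _ => ∅

/-- The truth value of an atomic order formula `t₀ ≤ t₁` as a function of signs:
`0 ≤ sign (t₁ - t₀)`. [folklore] -/
def relDec {n : ℕ} : ∀ {l : ℕ}, Language.orderedRing.Relations l →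
    (Fin l → Language.orderedRing.Term (α ⊕ Fin n)) →
    (MvPolynomial (α ⊕ Fin n) ℤ → SignType) → Prop
  | _, .le, ts, σ => 0 ≤ σ (termPoly (ts 1) - termPoly (ts 0))

/-- The truth value of a bounded formula as a Boolean function of an assignment of signs to
integer polynomials (meaningful for quantifier-free formulas: `realize_iff_dec`). [folklore] -/
def dec : ∀ {n : ℕ}, Language.orderedRing.BoundedFormula α n →
    (MvPolynomial (α ⊕ Fin n) ℤ → SignType) → Prop
  | _, .falsum, _ => False
  | _, .equal t₁ t₂, σ => σ (termPoly t₁ - termPoly t₂) = 0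
  | _, .rel R ts, σ => relDec R ts σ
  | _, .imp f₁ f₂, σ => dec f₁ σ → dec f₂ σ
  | _, .all _, _ => True

omit [DecidableEq α] in
/-- `relDec` only depends on the signs of the members of `relPolys`. [folklore] -/
theorem relDec_congr {n l : ℕ} (R : Language.orderedRing.Relations l)
    (ts : Fin l → Language.orderedRing.Term (α ⊕ Fin n))
    {σ σ' : MvPolynomial (α ⊕ Fin n) ℤ → SignType}
    (h : ∀ F ∈ relPolys (α := α) R ts, σ F = σ' F) : relDec R ts σ ↔ relDec R ts σ' := by
  cases R
  simp only [relDec]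
  rw [h _ (by simp [relPolys])]

/-- `dec φ` only depends on the signs of the members of `polys φ`. [folklore] -/
theorem dec_congr {n : ℕ} (φ : Language.orderedRing.BoundedFormula α n)
    {σ σ' : MvPolynomial (α ⊕ Fin n) ℤ → SignType} (h : ∀ F ∈ polys φ, σ F = σ' F) :
    dec φ σ ↔ dec φ σ' := by
  induction φ with
  | falsum => exact Iff.rfl
  | equal t₁ t₂ =>
    simp only [dec]
    rw [h _ (by simp [polys])]
  | rel R ts => exact relDec_congr R ts h
  | imp f₁ f₂ ih₁ ih₂ =>
    exact imp_congr (ih₁ fun F hF => h F (Finset.mem_union_left _ hF))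
      (ih₂ fun F hF => h F (Finset.mem_union_right _ hF))
  | all f _ => exact Iff.rfl

/-- The vector of signs of all integer polynomials at a point of an ordered ring. [folklore] -/
def sgn {γ R : Type*} [CommRing R] [LinearOrder R] (x : γ → R) : MvPolynomial γ ℤ → SignType :=
  fun F => SignType.sign (MvPolynomial.aeval x F)

omit [DecidableEq α] in
/-- **Quantifier-free formulas are sign conditions.** In an ordered commutative ring (with the
structure generated by its operations), a quantifier-free formula holds at a point iff `dec` holds
of the vector of signs of the integer polynomials at that point. [folklore] -/
theorem realize_iff_dec {R : Type*} [CommRing R] [LinearOrder R] [IsStrictOrderedRing R] {n : ℕ}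
    {φ : Language.orderedRing.BoundedFormula α n} (hφ : φ.IsQF) (v : α → R) (xs : Fin n → R) :
    φ.Realize v xs ↔ dec φ (sgn (Sum.elim v xs)) := by
  induction hφ with
  | falsum => exact Iff.rfl
  | of_isAtomic h =>
    cases h with
    | equal t₁ t₂ =>
      simp only [Term.bdEqual, BoundedFormula.Realize, dec, sgn, realize_eq_aeval_termPoly,
        map_sub, sign_eq_zero_iff, sub_eq_zero]
    | rel R ts =>
      cases R
      simp only [Relations.boundedFormula, BoundedFormula.Realize, dec, relDec, sgn,
        Language.orderedRing.relMap_le, realize_eq_aeval_termPoly, map_sub, sign_nonneg_iff,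
        sub_nonneg]
  | imp _ _ ih₁ ih₂ => exact imp_congr ih₁ ih₂

end SignConditions

/-! ### Models of `RCF` -/

section Models

variable {M : Type w} [instM : Language.orderedRing.Structure M]

/-- The identity map from an `Language.orderedRing`-structure to the ordered field
`OrderedFieldModel.Dom M` on its universe (a type synonym). [folklore] -/
def toDom : M → OrderedFieldModel.Dom M := fun x => x

/-- The identity map from `OrderedFieldModel.Dom M` back to `M`. [folklore] -/
def ofDom : OrderedFieldModel.Dom M → M := fun x => x

/-- `toDom ∘ ofDom = id`. [folklore] -/
@[simp] theorem toDom_ofDom (x : OrderedFieldModel.Dom M) : toDom (ofDom x) = x := rfl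

/-- `ofDom ∘ toDom = id`. [folklore] -/
@[simp] theorem ofDom_toDom (x : M) : ofDom (toDom x) = x := rfl

/-- Realization of a bounded formula in an `Language.orderedRing`-structure `M ⊨ Theory.orderedField`
is realization in the ordered field `OrderedFieldModel.Dom M` (whose structure, generated by its
operations, is the given one: `OrderedFieldModel.structure_eq`). [folklore] -/
theorem realize_dom_iff [M ⊨ Theory.orderedField] {α : Type*} {n : ℕ}
    (φ : Language.orderedRing.BoundedFormula α n) (v : α → M) (xs : Fin n → M) :
    BoundedFormula.Realize (M := OrderedFieldModel.Dom M) φ (toDom ∘ v) (toDom ∘ xs) ↔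
      φ.Realize v xs :=
  iff_of_eq (congrArg
    (fun S : Language.orderedRing.Structure M =>
      @BoundedFormula.Realize Language.orderedRing M S α n φ v xs)
    (OrderedFieldModel.structure_eq (M := M)))

end Models

/-! ### Elimination of one existential quantifier -/

section Elim

variable {α : Type} [DecidableEq α] {m : ℕ}

/-- The quantifier-free formula "the sign of the integer polynomial `c` is `s`". [folklore] -/
def signFormula (c : MvPolynomial (α ⊕ Fin m) ℤ) : SignType → Language.orderedRing.BoundedFormula α m
  | SignType.zero => Term.bdEqual (polyTerm c) 0
  | SignType.pos => ((polyTerm c).le 0).not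
  | SignType.neg => (Term.le 0 (polyTerm c)).not

omit [DecidableEq α] in
/-- `signFormula c s` is quantifier-free. [folklore] -/
theorem isQF_signFormula (c : MvPolynomial (α ⊕ Fin m) ℤ) (s : SignType) :
    (signFormula c s).IsQF := by
  cases s
  · exact (BoundedFormula.IsAtomic.equal _ _).isQF
  · exact (Language.leSymb.isQF _).not
  · exact (Language.leSymb.isQF _).not

omit [DecidableEq α] in
/-- Semantics of `signFormula` in an ordered commutative ring with the structure generated by its
operations. [folklore] -/
theorem realize_signFormula {R : Type*} [CommRing R] [LinearOrder R] [IsStrictOrderedRing R]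
    (c : MvPolynomial (α ⊕ Fin m) ℤ) (s : SignType) (v : α → R) (xs : Fin m → R) :
    (signFormula c s).Realize v xs ↔ SignType.sign (MvPolynomial.aeval (Sum.elim v xs) c) = s := by
  cases s
  · simp only [signFormula, BoundedFormula.realize_bdEqual, realize_polyTerm,
      Language.orderedRing.realize_zero, SignType.zero_eq_zero, sign_eq_zero_iff]
  · simp only [signFormula, BoundedFormula.realize_not, Term.realize_le, realize_polyTerm,
      Language.orderedRing.realize_zero, not_le, SignType.neg_eq_neg_one, sign_eq_neg_one_iff]
  · simp only [signFormula, BoundedFormula.realize_not, Term.realize_le, realize_polyTerm,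
      Language.orderedRing.realize_zero, not_le, SignType.pos_eq_one, sign_eq_one_iff]

omit [DecidableEq α] in
/-- Finite disjunctions of quantifier-free formulas are quantifier-free. [folklore] -/
theorem isQF_foldr_sup {n : ℕ} (l : List (Language.orderedRing.BoundedFormula α n))
    (h : ∀ φ ∈ l, φ.IsQF) : (l.foldr (· ⊔ ·) ⊥).IsQF := by
  induction l with
  | nil => exact BoundedFormula.isQF_bot
  | cons φ l ih =>
    exact (h φ (by simp)).sup (ih fun ψ hψ => h ψ (List.mem_cons_of_mem _ hψ))

omit [DecidableEq α] in
/-- Finite conjunctions of quantifier-free formulas are quantifier-free. [folklore] -/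
theorem isQF_foldr_inf {n : ℕ} (l : List (Language.orderedRing.BoundedFormula α n))
    (h : ∀ φ ∈ l, φ.IsQF) : (l.foldr (· ⊓ ·) ⊤).IsQF := by
  induction l with
  | nil => exact BoundedFormula.isQF_bot.not
  | cons φ l ih =>
    exact (h φ (by simp)).inf (ih fun ψ hψ => h ψ (List.mem_cons_of_mem _ hψ))

omit [DecidableEq α] in
/-- `BoundedFormula.iSup` of quantifier-free formulas is quantifier-free. [folklore] -/
theorem isQF_iSup {β : Type*} [Finite β] {n : ℕ} {f : β → Language.orderedRing.BoundedFormula α n}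
    (hf : ∀ b, (f b).IsQF) : (BoundedFormula.iSup f).IsQF := by
  unfold BoundedFormula.iSup
  exact isQF_foldr_sup _ fun φ hφ => by
    obtain ⟨b, -, rfl⟩ := List.mem_map.1 hφ
    exact hf b

omit [DecidableEq α] in
/-- `BoundedFormula.iInf` of quantifier-free formulas is quantifier-free. [folklore] -/
theorem isQF_iInf {β : Type*} [Finite β] {n : ℕ} {f : β → Language.orderedRing.BoundedFormula α n}
    (hf : ∀ b, (f b).IsQF) : (BoundedFormula.iInf f).IsQF := by
  unfold BoundedFormula.iInf
  exact isQF_foldr_inf _ fun φ hφ => by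
    obtain ⟨b, -, rfl⟩ := List.mem_map.1 hφ
    exact hf b

/-- The *good* sign conditions on a finite set `C` of integer polynomials in the free variables,
for a formula `χ(x̄, y)`: those realized at some point `x̄` of some model of `RCF` at which
`∃ y χ(x̄, y)` holds. [folklore] -/
def GoodSign (χ : Language.orderedRing.BoundedFormula α (m + 1))
    (C : Finset (MvPolynomial (α ⊕ Fin m) ℤ)) (τ : C → SignType) : Prop :=
  ∃ (M : Theory.ModelType.{0, 0, 0} Theory.RCF) (v : α → M) (xs : Fin m → M),
    (∀ c : C, SignType.sign (MvPolynomial.aeval (Sum.elim (toDom ∘ v) (toDom ∘ xs))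
      (c : MvPolynomial (α ⊕ Fin m) ℤ)) = τ c) ∧ ∃ y : M, χ.Realize v (Fin.snoc xs y)

/-- The eliminant: the disjunction over the good sign conditions `τ` on `C` of the formulas "the
signs of the members of `C` are `τ`". [folklore] -/
def elimFormula (χ : Language.orderedRing.BoundedFormula α (m + 1))
    (C : Finset (MvPolynomial (α ⊕ Fin m) ℤ)) : Language.orderedRing.BoundedFormula α m :=
  BoundedFormula.iSup fun τ : {τ : C → SignType // GoodSign χ C τ} =>
    BoundedFormula.iInf fun c : C => signFormula (c : MvPolynomial (α ⊕ Fin m) ℤ) (τ.1 c)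

omit [DecidableEq α] in
/-- The eliminant is quantifier-free. [folklore] -/
theorem isQF_elimFormula (χ : Language.orderedRing.BoundedFormula α (m + 1))
    (C : Finset (MvPolynomial (α ⊕ Fin m) ℤ)) : (elimFormula χ C).IsQF :=
  isQF_iSup fun _ => isQF_iInf fun _ => isQF_signFormula _ _

omit [DecidableEq α] in
/-- Semantics of the eliminant in a model of `RCF`: the signs of the members of `C` at the point
form a good sign condition. [folklore] -/
theorem realize_elimFormula (χ : Language.orderedRing.BoundedFormula α (m + 1))
    (C : Finset (MvPolynomial (α ⊕ Fin m) ℤ)) (M : Theory.ModelType.{0, 0, 0} Theory.RCF)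
    (v : α → M) (xs : Fin m → M) :
    (elimFormula χ C).Realize v xs ↔ GoodSign χ C fun c => SignType.sign
      (MvPolynomial.aeval (Sum.elim (toDom ∘ v) (toDom ∘ xs)) (c : MvPolynomial (α ⊕ Fin m) ℤ)) := by
  rw [← realize_dom_iff]
  simp only [elimFormula, BoundedFormula.realize_iSup, BoundedFormula.realize_iInf,
    realize_signFormula]
  constructor
  · rintro ⟨τ, hτ⟩
    convert τ.2 using 1
    funext c
    exact hτ c
  · intro h
    exact ⟨⟨_, h⟩, fun c => rfl⟩

/-- **Elimination of one existential quantifier** (the heart of Tarski's theorem): for every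
quantifier-free `χ(x̄, y)` there is a quantifier-free `θ(x̄)` with `RCF ⊨ (∃ y χ) ↔ θ`. Take for
`θ` the eliminant for the set `C` of coefficients of a finite stable family of polynomials in `y`
over `ℤ[x̄]` containing the polynomials of `χ`: if `θ` holds at `x̄` in `M ⊨ RCF`, the signs of `C`
at `x̄` agree with those at a point `x̄₀` of a model `M₀` where `χ(x̄₀, y₀)` holds, and the
parametric sign-diagram theorem between the real closed fields `M₀` and `M` produces `y ∈ M` at
which the polynomials of `χ` have the same signs as at `(x̄₀, y₀)`, so that `χ(x̄, y)` holds.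
[cite: BasuPollackRoy2006, Thm. 2.77] [cite: Marker2002, Thm. 3.3.15] -/
theorem exists_isQF_iff_ex (χ : Language.orderedRing.BoundedFormula α (m + 1)) (hχ : χ.IsQF) :
    ∃ θ : Language.orderedRing.BoundedFormula α m, θ.IsQF ∧ (χ.ex ⇔[Theory.RCF] θ) := by
  classical
  -- a stable family in `A[X]`, `A = ℤ[x̄]`, containing the polynomials of `χ`; its coefficients
  obtain ⟨P, hQP, hP⟩ := SignDiagram.exists_isStable_supset ((polys χ).image toAX)
  refine ⟨elimFormula χ (P.biUnion fun f => f.coeffs), isQF_elimFormula _ _, fun M v xs => ?_⟩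
  rw [BoundedFormula.realize_iff, BoundedFormula.realize_ex, realize_elimFormula]
  constructor
  · -- `∃ y χ` at `x̄` makes the sign condition of `x̄` good, witnessed by `M` itself
    rintro ⟨y, hy⟩
    exact ⟨M, v, xs, fun c => rfl, y, hy⟩
  · -- a good sign condition is realized with `∃ y χ` in some model `M₀`; transfer to `M`
    rintro ⟨M₀, v₀, xs₀, hsign₀, y₀, hy₀⟩
    haveI := OrderedFieldModel.isRealClosed (M := M₀)
    haveI := OrderedFieldModel.isRealClosed (M := M)
    have hsign : ∀ f ∈ P, ∀ i,
        SignType.sign ((MvPolynomial.aeval (Sum.elim (toDom ∘ v₀) (toDom ∘ xs₀))).toRingHom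
          (f.coeff i)) =
        SignType.sign ((MvPolynomial.aeval (Sum.elim (toDom ∘ v) (toDom ∘ xs))).toRingHom
          (f.coeff i)) := by
      intro f hf i
      by_cases h0 : f.coeff i = 0
      · simp [h0]
      · exact hsign₀ ⟨_, Finset.mem_biUnion.mpr ⟨f, hf, Polynomial.coeff_mem_coeffs h0⟩⟩
    obtain ⟨y', hy'⟩ := SignDiagramRCF.Transfer.exists_forall_sign_eval_map_eq _ _ P hP hsign
      (toDom y₀)
    refine ⟨ofDom y', ?_⟩
    -- `χ` at `(x̄₀, y₀)` in `M₀` and at `(x̄, y')` in `M` see the same signs of its polynomials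
    have h₀ := (realize_dom_iff χ v₀ (Fin.snoc xs₀ y₀)).2 hy₀
    rw [Fin.comp_snoc] at h₀
    replace h₀ := (realize_iff_dec hχ _ _).1 h₀
    refine (realize_dom_iff χ v (Fin.snoc xs (ofDom y'))).1 ?_
    rw [Fin.comp_snoc, toDom_ofDom]
    refine (realize_iff_dec hχ _ _).2 ((dec_congr χ fun F hF => ?_).1 h₀)
    have h1 := hy' _ (hQP (Finset.mem_image_of_mem _ hF))
    simp only [sgn]
    rw [← extend_sumElim, ← extend_sumElim, ← eval_map_toAX, ← eval_map_toAX]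
    exact h1

end Elim

/-! ### Quantifier elimination -/

/-- **Every formula is `RCF`-equivalent to a quantifier-free one** (induction on
`∃`/`¬`-complexity, eliminating one existential quantifier at a time).
[cite: Marker2002, Thm. 3.3.15] -/
theorem exists_isQF_iff {α : Type} [DecidableEq α] {n : ℕ}
    (φ : Language.orderedRing.BoundedFormula α n) :
    ∃ ψ : Language.orderedRing.BoundedFormula α n, ψ.IsQF ∧ (φ ⇔[Theory.RCF] ψ) := by
  refine φ.induction_on_exists_not
    (P := fun {k} (φ : Language.orderedRing.BoundedFormula α k) =>
      ∃ ψ : Language.orderedRing.BoundedFormula α k, ψ.IsQF ∧ (φ ⇔[Theory.RCF] ψ))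
    ?_ ?_ ?_ ?_
  · intro k ψ hψ
    exact ⟨ψ, hψ, Theory.Iff.refl _⟩
  · rintro k φ ⟨ψ, hψ, h⟩
    exact ⟨ψ.not, hψ.not, h.not⟩
  · rintro k φ ⟨ψ, hψ, h⟩
    obtain ⟨θ, hθ, hθ'⟩ := exists_isQF_iff_ex ψ hψ
    exact ⟨θ, hθ, h.ex.trans hθ'⟩
  · intro k φ₁ φ₂ h
    have h' : φ₁ ⇔[Theory.RCF] φ₂ := fun M v xs => by
      rw [BoundedFormula.realize_iff]
      exact h.realize_bd_iff
    exact ⟨fun ⟨ψ, hψ, h₁⟩ => ⟨ψ, hψ, h'.symm.trans h₁⟩,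
      fun ⟨ψ, hψ, h₂⟩ => ⟨ψ, hψ, h'.trans h₂⟩⟩

/-- **Tarski's theorem: the theory of real closed ordered fields admits quantifier elimination**
(Tarski 1951; Seidenberg 1954; Marker 2002, Thm. 3.3.15), for the axiomatization `Theory.RCF` of
`RealClosedFieldTheory.lean` in the language `(+, *, -, 0, 1, ≤)`.
[cite: Marker2002, Thm. 3.3.15] -/
theorem hasQE_RCF : Theory.RCF.HasQE := fun _ φ => exists_isQF_iff φ

end RCFQE

end Literature.ModelTheory.ExponentialFields
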